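/-
COR-CM (cell pub-hodgecm2 = stage 2 of the Hodge ladder), seat b26 gen 16 (prover-pub-hodgecm2-b26-g16-0, 2026-08-21);
count-neutral for the binder table (no row).  Sequel of `Assembly/CMEllipticCurveOfPeriod`: the endomorphism ALGEBRA
of the elliptic curve of a quadratic period.  Theorems only: no definition, no named fact, no instance.
-/
import Summits.HodgeConjecture.CorCM.Assembly.CMEllipticCurveOfPeriod
import HarnessLib

/-!
# `End⁰` of the elliptic curve of a quadratic period is the imaginary quadratic field `ℚ(τ)`

For a complex abelian variety `A` with `H¹_B(A) ≅ V¹_τ` in `Hod_ℚ`, `τ² + pτ + q = 0` (`p, q ∈ ℚ`), `τ ∉ ℝ`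
(`Assembly/CMEllipticCurveOfPeriod`: `A` is an elliptic curve of CM type), this file computes the endomorphism
algebra `End⁰(A) = ℚ ⊗ End A`:

* `exists_forall_bettiRep_mem_span` — the rational representation `End⁰(A) → (End_ℚ H¹(A(ℂ); ℚ))ᵒᵖ` takes values in
  the plane `ℚ·1 ⊕ ℚ·T`, `T = f⁻¹ M_τ f` the transport of the CM endomorphism of `V¹_τ` (every `F^*` is a Hodge
  endomorphism of `H¹_B(A)`, `BettiUniverse.pull_hodge`, hence of `V¹_τ` after transport, hence `x·1 + y·M_τ` by
  `PeriodHodgeStructure.hom_eq_smul_add_smul_cmMap`);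
* `finrank_endAlgebra_le_two`, **`finrank_endAlgebra_eq_two`** — `dim_ℚ End⁰(A) = 2` (upper bound by faithfulness
  `bettiRep_injective`; lower bound from `IsOfCMType`: a commutative reduced subalgebra of degree `2 dim A = 2`);
* **`endAlgebra_comm`**, `isReduced_endAlgebra` — `End⁰(A)` is commutative and reduced: with `finrank = 2` the CM
  subalgebra is everything, so **`End⁰(A)` is the imaginary quadratic field `ℚ[ψ] ≅ ℚ(√-d) = ℚ(τ)`** (Moonen–Zarhin
  Type IV(1,1): `End⁰ X = ` imaginary quadratic field; contrast gen 15's `NonCMCurve.finrank_endAlgebra_eq_one`,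
  `End⁰ = ℚ`, for non-quadratic `τ`);
* `finrank_endAlgebra_eq_ite` — for every `A` with `H¹_B(A) ≅ V¹_τ`, `τ ∉ ℝ`: `dim_ℚ End⁰(A)` is `2` or `1`
  according as `τ` does or does not satisfy a rational quadratic equation.

References: [MoonenZarhin1999LowDim] Math. Ann. 315 (1999), §2 (2.1) · [LangeBirkenhake1992] §1.1 (ρ_r injective),
§1.2 Prop. 1.2.3 · [Milne1999] §2 p. 54 · [DeligneMilne1982Tannakian] II Thm. 6.20.
-/

noncomputable section

open scoped TensorProduct
open CategoryTheory Module
open Literature.AlgebraicGeometry.Motives Literature.AlgebraicGeometry.HodgeTheory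
open Literature.AlgebraicGeometry.ComplexMultiplication
open Literature.AlgebraicGeometry.Motives.HodgeStructure

namespace Summit.HodgeConjecture.CorCM.PeriodCurve

section Period

variable {τ : ℂ} {ω : ℂ ⊗[ℚ] (Fin 2 → ℚ)} (h0 : TensorProduct.piScalarRight ℚ ℂ ℂ (Fin 2) ω 0 = 1)
  (h1 : TensorProduct.piScalarRight ℚ ℂ ℂ (Fin 2) ω 1 = τ) (hP : IsCompl (ℂ ∙ ω) (complexConj (ℂ ∙ ω)))
  {A : AbelianVariety ℂ} {B : HodgeModel A.dim A.X} {hB : B.IsHodgeSymmetric}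
  (f : Hom (bettiOneHodgeStructure A B hB) (ofSplitting (ℂ ∙ ω) hP one_pos : HodgeStructure (Fin 2 → ℚ) 1))
  (hf : Function.Bijective f.toLinearMap) {p q : ℚ} (hτ2 : τ ^ 2 + p * τ + q = 0)

include f hf in
/-- **Every endomorphism of `A` acts on `H¹(A(ℂ); ℚ)` through `End(V¹_τ)`**: for `F ∈ End A`, the Hodge
endomorphism `F^*` of `H¹_B(A)` (`BettiUniverse.pull_hodge`), transported to `V¹_τ ≅ H¹_B(A)`, is an endomorphism
`S` of `V¹_τ` with `F^* = f⁻¹ ∘ S ∘ f`. [cite: VoisinHodgeI2002, §7.3.2] [cite: LangeBirkenhake1992, §1.2 Prop. 1.2.3] -/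
theorem exists_hom_pull_eq (F : End A) :
    ∃ S : Hom (ofSplitting (ℂ ∙ ω) hP one_pos : HodgeStructure (Fin 2 → ℚ) 1) (ofSplitting (ℂ ∙ ω) hP one_pos),
      ∀ v, (bettiCohomology.map F.hom.hom.hom 1).hom v =
        (f.symmOfBijective hf).toLinearMap (S.toLinearMap (f.toLinearMap v)) := by
  have hX := AbelianVariety.isSmoothProjective_holds (A := A)
  have e := bettiOneHodgeStructure_eq_cast_hodge exists_isReal_hodgeModel_holds
    hodgePQ_independent_of_hodgeModel_holds A B hB hX
  have hF := BettiUniverse.pull_hodge exists_isReal_hodgeModel_holds hodgePQ_independent_of_hodgeModel_holds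
    hX hX F.hom.hom.hom 1
  let TF : Hom (bettiOneHodgeStructure A B hB) (bettiOneHodgeStructure A B hB) :=
    ⟨BettiUniverse.pull F.hom.hom.hom 1, fun p => by rw [e, cast_F]; exact hF p⟩
  refine ⟨f.comp (TF.comp (f.symmOfBijective hf)), fun v => ?_⟩
  change TF.toLinearMap v = (f.symmOfBijective hf).toLinearMap (f.toLinearMap (TF.toLinearMap
    ((f.symmOfBijective hf).toLinearMap (f.toLinearMap v))))
  rw [Hom.symmOfBijective_apply_apply, Hom.symmOfBijective_apply_apply]

include h0 h1 f hf hτ2 in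
/-- **The rational representation of `End⁰(A)` takes values in the plane `ℚ·1 ⊕ ℚ·T`, `T = f⁻¹ M_τ f`** (for
`H¹_B(A) ≅ V¹_τ`, `τ² + pτ + q = 0`, `τ ∉ ℝ`): every element of `End⁰(A)` is `N⁻¹(1 ⊗ F)`, and `F^* = f⁻¹ S f` with
`S = x·1 + y·M_τ` (`PeriodHodgeStructure.hom_eq_smul_add_smul_cmMap`).
[cite: MoonenZarhin1999LowDim, §2 (2.1) (g = 1), Type IV(1,1)] [cite: LangeBirkenhake1992, §1.1 and §1.2 Prop. 1.2.3] -/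
theorem exists_forall_bettiRep_mem_span (hτ : τ.im ≠ 0) :
    ∃ T : bettiCohomology A.X 1 →ₗ[ℚ] bettiCohomology A.X 1, ∀ x : A.endAlgebra,
      bettiRep A x ∈ Submodule.span ℚ {MulOpposite.op LinearMap.id, MulOpposite.op T} := by
  refine ⟨(f.symmOfBijective hf).toLinearMap ∘ₗ Matrix.toLin' !![(0 : ℚ), 1; -q, -p] ∘ₗ f.toLinearMap, fun x => ?_⟩
  set T := (f.symmOfBijective hf).toLinearMap ∘ₗ Matrix.toLin' !![(0 : ℚ), 1; -q, -p] ∘ₗ f.toLinearMap with hT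
  obtain ⟨N, F, hN, rfl⟩ := AbelianVariety.endAlgebra.exists_eq_algebraMap_mul_of x
  obtain ⟨S, hS⟩ := exists_hom_pull_eq hP f hf F
  obtain ⟨a, b, hab⟩ := PeriodHodgeStructure.hom_eq_smul_add_smul_cmMap h0 h1 hP hτ2 hτ S
  have hψ : (bettiCohomology.map F.hom.hom.hom 1).hom = a • LinearMap.id + b • T := by
    refine LinearMap.ext fun v => ?_
    rw [hS v, hab]
    simp only [LinearMap.add_apply, LinearMap.smul_apply, LinearMap.id_apply, map_add, map_smul, hT,
      LinearMap.comp_apply, Hom.symmOfBijective_apply_apply]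
  rw [map_mul, AlgHom.commutes, bettiRep_of, hψ, Algebra.algebraMap_eq_smul_one, smul_mul_assoc, one_mul,
    MulOpposite.op_add, MulOpposite.op_smul, MulOpposite.op_smul]
  refine Submodule.smul_mem _ _ (Submodule.add_mem _ (Submodule.smul_mem _ _ (Submodule.subset_span (by simp)))
    (Submodule.smul_mem _ _ (Submodule.subset_span (by simp))))

include h0 h1 f hf hτ2 in
/-- **`dim_ℚ End⁰(A) ≤ 2`** for `H¹_B(A) ≅ V¹_τ` with `τ` quadratic, `τ ∉ ℝ`: the rational representation is injective
(`bettiRep_injective`) with values in a plane. [cite: LangeBirkenhake1992, §1.1 (ρ_r injective) and §1.2 Prop. 1.2.3]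
[cite: MoonenZarhin1999LowDim, §2 (2.1) (g = 1), Type IV(1,1)] -/
theorem finrank_endAlgebra_le_two (hτ : τ.im ≠ 0) : Module.finrank ℚ A.endAlgebra ≤ 2 := by
  classical
  obtain ⟨T, hT⟩ := exists_forall_bettiRep_mem_span h0 h1 hP f hf hτ2 hτ
  set s : Finset (Module.End ℚ (bettiCohomology A.X 1))ᵐᵒᵖ := {MulOpposite.op LinearMap.id, MulOpposite.op T}
  have hs : (↑s : Set (Module.End ℚ (bettiCohomology A.X 1))ᵐᵒᵖ) = {MulOpposite.op LinearMap.id, MulOpposite.op T} := by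
    simp [s]
  have hrange : LinearMap.range (bettiRep A).toLinearMap ≤ Submodule.span ℚ (↑s) := by
    rintro _ ⟨x, rfl⟩
    rw [hs]
    exact hT x
  haveI : FiniteDimensional ℚ (Submodule.span ℚ (↑s : Set (Module.End ℚ (bettiCohomology A.X 1))ᵐᵒᵖ)) :=
    FiniteDimensional.span_finset ℚ s
  calc Module.finrank ℚ A.endAlgebra
      = Module.finrank ℚ (LinearMap.range (bettiRep A).toLinearMap) :=
        (LinearMap.finrank_range_of_inj (bettiRep_injective (A := A))).symm
    _ ≤ Module.finrank ℚ (Submodule.span ℚ (↑s : Set (Module.End ℚ (bettiCohomology A.X 1))ᵐᵒᵖ)) :=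
        Submodule.finrank_mono hrange
    _ ≤ s.card := finrank_span_finset_le_card s
    _ ≤ 2 := Finset.card_le_two

include h0 h1 f hf hτ2 in
/-- **`dim_ℚ End⁰(A) = 2` for `H¹_B(A) ≅ V¹_τ` with `τ` quadratic, `τ ∉ ℝ`** (Moonen–Zarhin Type IV(1,1): `End⁰` is an
imaginary quadratic field): `≤ 2` by `finrank_endAlgebra_le_two`, `≥ 2` because `A` is of CM type (a commutative
reduced subalgebra of degree `2 dim A = 2`, `PeriodCurve.isOfCMType`). [cite: MoonenZarhin1999LowDim, §2 (2.1) (g = 1), Type IV(1,1)]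
[cite: Milne1999, §2 p. 54] -/
theorem finrank_endAlgebra_eq_two (hτ : τ.im ≠ 0) : Module.finrank ℚ A.endAlgebra = 2 := by
  refine le_antisymm (finrank_endAlgebra_le_two h0 h1 hP f hf hτ2 hτ) ?_
  obtain ⟨S, -, -, hS⟩ := isOfCMType h0 h1 hP f hf hτ2 hτ
  haveI : Module.Finite ℚ A.endAlgebra := AbelianVariety.finiteDimensional_endAlgebra_holds A
  have hle := Submodule.finrank_le (Subalgebra.toSubmodule S)
  rw [Subalgebra.finrank_toSubmodule, hS, dim_eq_one hP f hf] at hle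
  exact hle

include h0 h1 f hf hτ2 in
/-- **The CM subalgebra is all of `End⁰(A)`**: every commutative reduced subalgebra of degree `2 dim A` given by
`IsOfCMType A` — indeed every subalgebra of `ℚ`-dimension `2` — equals `⊤`, since `dim_ℚ End⁰(A) = 2`.
[cite: MoonenZarhin1999LowDim, §2 (2.1) (g = 1), Type IV(1,1)] [cite: Milne1999, §2 p. 54] -/
theorem subalgebra_eq_top_of_finrank_eq_two (hτ : τ.im ≠ 0) (S : Subalgebra ℚ A.endAlgebra)
    (hS : Module.finrank ℚ S = 2) : S = ⊤ := by
  haveI : FiniteDimensional ℚ (⊤ : Subalgebra ℚ A.endAlgebra) := AbelianVariety.endAlgebra.moduleFinite_subalgebra ⊤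
  refine Subalgebra.eq_of_le_of_finrank_eq le_top ?_
  rw [hS, Subalgebra.topEquiv.toLinearEquiv.finrank_eq, finrank_endAlgebra_eq_two h0 h1 hP f hf hτ2 hτ]

include h0 h1 f hf hτ2 in
/-- **`End⁰(A)` is commutative** for `H¹_B(A) ≅ V¹_τ` with `τ` quadratic, `τ ∉ ℝ` (it is the CM field).
[cite: MoonenZarhin1999LowDim, §2 (2.1) (g = 1), Type IV(1,1)] -/
theorem endAlgebra_comm (hτ : τ.im ≠ 0) (x y : A.endAlgebra) : x * y = y * x := by
  obtain ⟨S, -, hcomm, hS⟩ := isOfCMType h0 h1 hP f hf hτ2 hτ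
  rw [dim_eq_one hP f hf] at hS
  have htop := subalgebra_eq_top_of_finrank_eq_two h0 h1 hP f hf hτ2 hτ S hS
  exact hcomm x (htop ▸ Algebra.mem_top) y (htop ▸ Algebra.mem_top)

include h0 h1 f hf hτ2 in
/-- **`End⁰(A)` is reduced** for `H¹_B(A) ≅ V¹_τ` with `τ` quadratic, `τ ∉ ℝ` (with `endAlgebra_comm` and
`finrank_endAlgebra_eq_two`: `End⁰(A)` is a commutative reduced `ℚ`-algebra of dimension `2` containing `ψ` with
`ψ² = -d`, i.e. the imaginary quadratic field `ℚ(√-d) = ℚ(τ)`). [cite: MoonenZarhin1999LowDim, §2 (2.1) (g = 1), Type IV(1,1)]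
[cite: Milne1999, §2 p. 54] -/
theorem isReduced_endAlgebra (hτ : τ.im ≠ 0) : IsReduced A.endAlgebra := by
  obtain ⟨S, hred, -, hS⟩ := isOfCMType h0 h1 hP f hf hτ2 hτ
  rw [dim_eq_one hP f hf] at hS
  have htop := subalgebra_eq_top_of_finrank_eq_two h0 h1 hP f hf hτ2 hτ S hS
  refine ⟨fun x hx => ?_⟩
  have hx' : IsNilpotent (⟨x, htop ▸ Algebra.mem_top⟩ : S) := by
    obtain ⟨k, hk⟩ := hx
    exact ⟨k, Subtype.ext (by simpa using hk)⟩
  simpa using congrArg Subtype.val (hred.eq_zero _ hx')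

omit hτ2 in
include h0 h1 f hf in
/-- **`dim_ℚ End⁰(A)` on the period**: for every complex abelian variety `A` with `H¹_B(A) ≅ V¹_τ`, `τ ∉ ℝ`,
`dim_ℚ End⁰(A) = 2` if `τ` satisfies a rational quadratic equation (Type IV(1,1)) and `= 1` otherwise (Type I(1),
gen 15's `NonCMCurve.finrank_endAlgebra_eq_one`). [cite: MoonenZarhin1999LowDim, §2 (2.1) (g = 1)]
[cite: DeligneMilne1982Tannakian, art. II §6 Thm. 6.20 (Riemann), LNM 900 p. 212] -/
theorem finrank_endAlgebra_eq_ite (hτ : τ.im ≠ 0) [Decidable (∃ a b c : ℚ, a ≠ 0 ∧ (a : ℂ) * τ ^ 2 + b * τ + c = 0)] :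
    Module.finrank ℚ A.endAlgebra =
      if ∃ a b c : ℚ, a ≠ 0 ∧ (a : ℂ) * τ ^ 2 + b * τ + c = 0 then 2 else 1 := by
  split_ifs with h
  · obtain ⟨a, b, c, ha, habc⟩ := h
    have hτ2' : τ ^ 2 + (b / a : ℚ) * τ + (c / a : ℚ) = 0 := by
      have ha' : (a : ℂ) ≠ 0 := by exact_mod_cast ha
      push_cast
      field_simp
      linear_combination habc
    exact finrank_endAlgebra_eq_two h0 h1 hP f hf hτ2' hτ
  · exact NonCMCurve.finrank_endAlgebra_eq_one f hf ((PeriodHodgeStructure.forall_hom_eq_smul_iff h0 h1 hP hτ).2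
      ((PeriodHodgeStructure.noQuadratic_iff hτ).2 h)) (by rw [dim_eq_one hP f hf]; exact one_pos)

end Period

/-! ## Export at the level of `τ` -/

/-- **For `Im τ > 0` and `τ² + pτ + q = 0` there is a complex elliptic curve `E` with `H¹_B(E) ≅ V¹_τ` whose
endomorphism algebra `End⁰(E)` is a commutative reduced `ℚ`-algebra of dimension `2`** (the imaginary quadratic
field `ℚ(τ)`; Moonen–Zarhin Type IV(1,1)), complementing gen 15's non-CM curve with `End⁰ = ℚ`.
[cite: MoonenZarhin1999LowDim, §2 (2.1) (g = 1), Type IV(1,1)] [cite: DeligneMilne1982Tannakian, art. II §6 Thm. 6.20 (Riemann), LNM 900 p. 212] -/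
theorem exists_ellipticCurve_finrank_endAlgebra_eq_two {τ : ℂ} (hτ' : 0 < τ.im) {p q : ℚ}
    (hτ2 : τ ^ 2 + p * τ + q = 0) :
    ∃ E : AbelianVariety ℂ, E.dim = 1 ∧ Module.finrank ℚ E.endAlgebra = 2 ∧
      (∀ x y : E.endAlgebra, x * y = y * x) ∧ IsReduced E.endAlgebra ∧
      Literature.AlgebraicGeometry.Milne1999.IsOfCMType E := by
  obtain ⟨h0, h1⟩ := coords_periodVector τ
  have hP := PeriodHodgeStructure.isCompl_span h0 h1 hτ'.ne'
  obtain ⟨E, B, hB, f, hf, hE⟩ := exists_ellipticCurve h0 h1 hP hτ'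
  exact ⟨E, hE, finrank_endAlgebra_eq_two h0 h1 hP f hf hτ2 hτ'.ne', endAlgebra_comm h0 h1 hP f hf hτ2 hτ'.ne',
    isReduced_endAlgebra h0 h1 hP f hf hτ2 hτ'.ne', isOfCMType h0 h1 hP f hf hτ2 hτ'.ne'⟩

end Summit.HodgeConjecture.CorCM.PeriodCurve

end
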